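import Summits.QuantumFields.BalabanUV.Beta.BorderedHessianRooted
import Summits.QuantumFields.BalabanUV.Beta.ChartConjugation

/-!
# The DIAGONAL CONTACT of the product chart: `conjV 𝕄 (diagK g)` is the entrywise commutator `𝕄·(g(col) − g(row))`, it commutes with
# `axEc`, and for the rooted bordered Hessian `bhKAt ctr L` it REPRODUCES an5's packed contact stencil `packVH (ctE α L)` on the
# field–multiplier blocks (β sub-cell, row BETA-an2, gen 14; NOTE X-an2-45 §3 — the kernel form of toy V2; item (R45-4)(ii))

HONEST FRAMING (cell charter, verbatim): «discharging BetaPertH makes Balaban's UV stability UNCONDITIONAL — a real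
constructive-QFT result; it is NOT the continuum limit and NOT the Clay problem.»  DERIVED cell leaf (pub-balaban β sub-cell, lane
an2 gen 14); no statement of Bałaban's papers is typed here, no `[cite:]` tag, no `Prop` fact; it instantiates no binder of the
β-function wall by itself.  NOT `BetaPertH`; NOT continuum; NOT Clay.

## What is here ([folklore] kernel algebra; every identity entrywise, no summability beyond point-supported sums)

* §1 `diagK g` — the DIAGONAL kernel with symbol `g : site → fibre leg → ℝ`; `comp_diagK_right/left` (right/left composition = entrywise
  multiplication by `g(col)`/`g(row)`), **`conjV_diagK_apply : conjV M (diagK g) x z a b = M x z a b * (g z b − g x a)`**,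
  **`comp_axEc_diagK_comm : axEc ∘ diagK g = diagK g ∘ axEc`** (the socket hEC of the coarse wiring, for diagonal contacts), `decays_diagK`.
* §2 the bridge `off L z = 0 ↔ proj L z = 0` (an1's block letters vs an2's torus letters; `blk = quo` is `rfl`), and
  `linAvgAt_delta1_eq_pow_mul_linKerAt` (`linAvgAt ρ (delta1 l y) L κ y′ = L^{d+1} · linKerAt ρ L κ y′ (l, y)`).
* §3 THE PRODUCT-CHART GENERATOR at the jet bond `(κ′, u)` for the reflection of axis `α`:
  `ctGen α L κ′ u x (inl β) = −[x = u ∧ β = κ′ ∧ κ′ = α]` (the same-bond BCH letter on α-parallel jet bonds),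
  `ctGen α L κ′ u z (inr μ) = −[μ = α]·[off L z = 0]·q¹_{(μ, blk z)}(κ′, u)` (the rank-one letter on the reflected coarse axis); and
  **THE IDENTITY** (`conjV_bhKAt_ctGen_inl_inr` / `_inr_inl`): on both field–multiplier blocks
  `conjV (bhKAt (ctr (d+1) L) L) (diagK (ctGen α L κ′ u)) = −L^{d+1} · packVH (ctE α L) L κ′ u` — an5's packed contact stencil
  (`RootedKernelReflection.ctE`, `vhSAt_bref`) IS an infinitesimal DIAGONAL re-charting of the rooted bordered Hessian, in SYMMETRIC
  off-diagonal placement; the multiplier–multiplier block vanishes (`conjV_bhKAt_ctGen_inr_inr`) and the field–field block is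
  `[κ′ = α]·(d*d-window entry)·([z = u ∧ b = κ′] − [x = u ∧ a = κ′])` (`conjV_bhKAt_ctGen_inl_inl`) — the predicted product-chart
  contact of the Wilson piece (NOTE X-an2-45 §3; to be matched against an3's `wilsonVertex₁`).

READING (context; asserted nowhere): with the native (symmetric) placement of the vh-piece ((R45-1)) the (Sr-conj) socket of the coarse
wiring at `j = 0` takes `C 0 α κ′ u := (cVH/L^{d+1}) • diagK (ctGen α L κ′ u)` for the vh-part; rules 3–4 against `bhKAt` are
`BorderedHessianRooted.relInv_coDressKBmAt_KInvStep_zero_bhKAt`; hEC is §1.  All declarations `[folklore]`; axioms standard.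
Provenance: b2b-balaban β sub-cell, unit beta-an2 gen 14, 2026-08-20 (v1); over `BorderedHessianRooted` (an2), an5's
`RootedKernelReflection` (`ctE`, `packVH` laws), an1's `AveragingHessianKernels(Rooted)` BY NAME; no existing file touched.
-/

open Finset
open scoped BigOperators
open Literature.Probability.LatticeModels (TorusSite Torus.proj Torus.proj_apply)
open Literature.MathematicalPhysics.QuantumFieldTheory
open Literature.MathematicalPhysics.QuantumFieldTheory.Balaban1983to89
open Literature.MathematicalPhysics.QuantumFieldTheory.Balaban1983to89.Beta
open B12Sec2to5 (l1 l1_nonneg)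
open ExpKernelCalculus (MKer Decays comp)
open AffineAveraging (box toSite)
open AveragingContours (blk off blk_add_off toSite_zero)
open AveragingContoursRooted (ctr ctrOff ctrOff_mem_box linAvgAt)
open AveragingHessianKernels (Bond packVH packVH_inl_inr packVH_inr_inl eq_smul_blk_of_off_eq_zero)
open AveragingHessianKernelsRooted (linCountAt linKerAt)
open RootedKernelReflection (ctE off_zsmul)
open KKTFluctuationKernel (delta1)
open LatticeForm (quo)
open OneStepResolventKernel (Fib quo_zsmul eq_zsmul_quo_of_proj proj_zsmul)
open Summit.QuantumFields.BalabanUV.Beta.TameKernelCalculus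
open Summit.QuantumFields.BalabanUV.Beta.ChartConjugation (conjV)
open Summit.QuantumFields.BalabanUV.Beta.AxialDressingRooted (IsCombBondAt axEc axEc_inl_inl axEc_inl_inr axEc_inr_inl axEc_inr_inr
  tsum_point tsum_point' one_le_of_neZero)

namespace Summit.QuantumFields.BalabanUV.Beta.BorderedHessian

noncomputable section

variable {d : ℕ}

/-! ## §1 Diagonal kernels -/

section Diag

open Classical in
/-- [folklore] **THE DIAGONAL KERNEL** with symbol `g`: `(diagK g) x y a b = [x = y ∧ a = b]·g x a`. -/
def diagK (g : (Fin (d + 1) → ℤ) → Fib d → ℝ) : MKer (d + 1) (Fib d) :=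
  fun x y a b => if x = y ∧ a = b then g x a else 0

variable (g : (Fin (d + 1) → ℤ) → Fib d → ℝ)

open Classical in
/-- [folklore] Entries of `diagK`. -/
theorem diagK_apply (x y : Fin (d + 1) → ℤ) (a b : Fib d) : diagK g x y a b = if x = y ∧ a = b then g x a else 0 := rfl

/-- [folklore] RIGHT composition with a diagonal kernel multiplies each entry by the symbol at the COLUMN leg. -/
theorem comp_diagK_right (K : MKer (d + 1) (Fib d)) (x z : Fin (d + 1) → ℤ) (a b : Fib d) :
    comp K (diagK g) x z a b = K x z a b * g z b := by
  classical
  unfold ExpKernelCalculus.comp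
  have h : ∀ y, ∑ f : Fib d, K x y a f * diagK g y z f b = if y = z then K x y a b * g z b else 0 := by
    intro y
    by_cases hy : y = z
    · subst hy
      rw [if_pos rfl, Finset.sum_eq_single b (fun f _ hf => by rw [diagK_apply, if_neg (fun h => hf h.2), mul_zero])
        (fun h => absurd (Finset.mem_univ _) h), diagK_apply, if_pos ⟨rfl, rfl⟩]
    · rw [if_neg hy]
      exact Finset.sum_eq_zero fun f _ => by rw [diagK_apply, if_neg (fun h => hy h.1), mul_zero]
  simp_rw [h]
  exact tsum_point' z fun y => K x y a b * g z b

/-- [folklore] LEFT composition with a diagonal kernel multiplies each entry by the symbol at the ROW leg. -/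
theorem comp_diagK_left (K : MKer (d + 1) (Fib d)) (x z : Fin (d + 1) → ℤ) (a b : Fib d) :
    comp (diagK g) K x z a b = g x a * K x z a b := by
  classical
  unfold ExpKernelCalculus.comp
  have h : ∀ y, ∑ f : Fib d, diagK g x y a f * K y z f b = if x = y then g x a * K y z a b else 0 := by
    intro y
    by_cases hy : x = y
    · subst hy
      rw [if_pos rfl, Finset.sum_eq_single a (fun f _ hf => by rw [diagK_apply, if_neg (fun h => hf h.2.symm), zero_mul])
        (fun h => absurd (Finset.mem_univ _) h), diagK_apply, if_pos ⟨rfl, rfl⟩]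
    · rw [if_neg hy]
      exact Finset.sum_eq_zero fun f _ => by rw [diagK_apply, if_neg (fun h => hy h.1), zero_mul]
  simp_rw [h]
  exact tsum_point x fun y => g x a * K y z a b

/-- [folklore] **THE CONTACT OF A DIAGONAL GENERATOR IS ENTRYWISE**: `conjV M (diagK g) x z a b = M x z a b · (g z b − g x a)`. -/
theorem conjV_diagK_apply (M : MKer (d + 1) (Fib d)) (x z : Fin (d + 1) → ℤ) (a b : Fib d) :
    conjV M (diagK g) x z a b = M x z a b * (g z b - g x a) := by
  unfold ChartConjugation.conjV
  rw [Pi.sub_apply, Pi.sub_apply, Pi.sub_apply, Pi.sub_apply, comp_diagK_right, comp_diagK_left]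
  ring

/-- [folklore] **DIAGONAL CONTACTS COMMUTE WITH THE COARSE COORDINATE PROJECTOR** (socket hEC of the coarse wiring). -/
theorem comp_axEc_diagK_comm (ρ : Fin (d + 1) → ℤ) (N : ℕ) : comp (axEc ρ N) (diagK g) = comp (diagK g) (axEc ρ N) := by
  classical
  funext x z a b
  rw [comp_diagK_right, comp_diagK_left]
  rcases a with α | m <;> rcases b with β | m'
  · rw [axEc_inl_inl]
    by_cases h : x = z ∧ α = β ∧ ¬ IsCombBondAt ρ N α x
    · obtain ⟨rfl, rfl, -⟩ := h; ring
    · rw [if_neg h, zero_mul, mul_zero]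
  · rw [axEc_inl_inr, zero_mul, mul_zero]
  · rw [axEc_inr_inl, zero_mul, mul_zero]
  · rw [axEc_inr_inr]
    by_cases h : x = z ∧ m = m' ∧ Torus.proj N x = 0
    · obtain ⟨rfl, rfl, -⟩ := h; ring
    · rw [if_neg h, zero_mul, mul_zero]

/-- [folklore] A diagonal kernel with bounded symbol decays at every rate. -/
theorem decays_diagK {B : ℝ} (hB : ∀ x a, |g x a| ≤ B) (δ : ℝ) : Decays (diagK g) B δ := by
  classical
  intro x y a b
  rw [diagK_apply]
  split_ifs with h
  · obtain ⟨rfl, rfl⟩ := h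
    rw [sub_self]
    simp only [B12Sec2to5.l1, Pi.zero_apply, Int.cast_zero, abs_zero, Finset.sum_const_zero, mul_zero, Real.exp_zero, mul_one]
    exact hB x a
  · rw [abs_zero]
    exact mul_nonneg ((abs_nonneg _).trans (hB x a)) (Real.exp_pos _).le

end Diag

/-! ## §2 Bridges between an1's block letters and an2's torus letters -/

section Bridges

variable {L : ℕ}

/-- [folklore] `off L z = 0 ↔ proj L z = 0`. -/
theorem off_eq_zero_iff_proj [NeZero L] (z : Fin (d + 1) → ℤ) : off L z = 0 ↔ Torus.proj L z = 0 := by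
  constructor
  · intro h
    rw [eq_smul_blk_of_off_eq_zero (one_le_of_neZero L) h]
    exact proj_zsmul _
  · intro h
    rw [eq_zsmul_quo_of_proj (N := L) h]
    exact off_zsmul L _

/-- [folklore] `blk L z = quo L z` (definitional). -/
theorem blk_eq_quo (z : Fin (d + 1) → ℤ) : blk L z = quo L z := rfl

/-- [folklore] The rooted averaging of a bond indicator in an1's normalisation: `linAvgAt ρ (delta1 l y) L κ y′ = L^{d+1}·q¹`. -/
theorem linAvgAt_delta1_eq_pow_mul_linKerAt [NeZero L] (ρ : Fin (d + 1) → ℤ) (l : Fin (d + 1)) (y : Fin (d + 1) → ℤ)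
    (κ : Fin (d + 1)) (y' : Fin (d + 1) → ℤ) : linAvgAt ρ (delta1 l y) L κ y' = (L : ℝ) ^ (d + 1) * linKerAt ρ L κ y' (l, y) := by
  rw [linAvgAt_delta1_eq_cast, AveragingHessianKernelsRooted.linKerAt]
  have hL : (L : ℝ) ^ (d + 1) ≠ 0 := pow_ne_zero _ (by exact_mod_cast NeZero.ne L)
  rw [mul_div_cancel₀ _ hL]

end Bridges

/-! ## §3 The product-chart generator and the identity with an5's packed contact stencil -/

section Contact

variable (d)

open Classical in
/-- [folklore] **THE PRODUCT-CHART GENERATOR** (colourless, DIAGONAL) at the jet bond `(κ′, u)` for the reflection of axis `α`: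
field leg `(x, β) ↦ −[x = u ∧ β = κ′ ∧ κ′ = α]` (same-bond BCH letter on α-parallel jet bonds), multiplier leg
`(z, μ) ↦ −[μ = α]·[off L z = 0]·q¹_{(μ, blk z)}(κ′, u)` (rank-one letter on the reflected coarse axis). -/
def ctGen (α : Fin (d + 1)) (L : ℕ) (κ' : Fin (d + 1)) (u : Fin (d + 1) → ℤ) : (Fin (d + 1) → ℤ) → Fib d → ℝ :=
  fun x a =>
    match a with
    | Sum.inl β => if x = u ∧ β = κ' ∧ κ' = α then -1 else 0
    | Sum.inr μ => if μ = α ∧ off L x = 0 then -(linKerAt (ctr (d + 1) L) L μ (blk L x) (κ', u)) else 0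

variable {d} (α : Fin (d + 1)) (L : ℕ) (κ' : Fin (d + 1)) (u : Fin (d + 1) → ℤ)

open Classical in
/-- [folklore] Field leg of the generator. -/
theorem ctGen_inl (x : Fin (d + 1) → ℤ) (β : Fin (d + 1)) :
    ctGen d α L κ' u x (Sum.inl β) = if x = u ∧ β = κ' ∧ κ' = α then -1 else 0 := rfl

open Classical in
/-- [folklore] Multiplier leg of the generator. -/
theorem ctGen_inr (z : Fin (d + 1) → ℤ) (μ : Fin (d + 1)) :
    ctGen d α L κ' u z (Sum.inr μ) = if μ = α ∧ off L z = 0 then -(linKerAt (ctr (d + 1) L) L μ (blk L z) (κ', u)) else 0 := rfl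

/-- [folklore] **THE IDENTITY, field–multiplier block**: `conjV (bhKAt ctr L) (diagK ctGen) = −L^{d+1}·packVH (ctE α L)` on `(inl β, inr μ)`. -/
theorem conjV_bhKAt_ctGen_inl_inr [NeZero L] (x z : Fin (d + 1) → ℤ) (β μ : Fin (d + 1)) :
    conjV (bhKAt d (ctr (d + 1) L) L) (diagK (ctGen d α L κ' u)) x z (Sum.inl β) (Sum.inr μ) =
      -((L : ℝ) ^ (d + 1)) * packVH (ctE α L) L κ' u x z (Sum.inl β) (Sum.inr μ) := by
  classical
  rw [conjV_diagK_apply, bhKAt_inl_inr, packVH_inl_inr, ctGen_inl, ctGen_inr]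
  by_cases hz : off L z = 0
  · have hz' : Torus.proj L z = 0 := (off_eq_zero_iff_proj z).1 hz
    rw [if_pos hz', if_pos hz, linAvgAt_delta1_eq_pow_mul_linKerAt, ← blk_eq_quo]
    simp only [RootedKernelReflection.ctE, hz, and_true]
    have e : (x = u ∧ β = κ' ∧ κ' = α) ↔ ((β, x) = (κ', u) ∧ β = α) :=
      ⟨fun h => ⟨by rw [h.1, h.2.1], h.2.1.trans h.2.2⟩, fun h => ⟨(Prod.mk.inj h.1).2, (Prod.mk.inj h.1).1,
        (Prod.mk.inj h.1).1.symm.trans h.2⟩⟩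
    simp only [e]
    split_ifs <;> ring
  · have hz' : ¬ Torus.proj L z = 0 := fun h => hz ((off_eq_zero_iff_proj z).2 h)
    rw [if_neg hz', if_neg hz, zero_mul, mul_zero]

/-- [folklore] **THE IDENTITY, multiplier–field block**: the symmetric twin. -/
theorem conjV_bhKAt_ctGen_inr_inl [NeZero L] (x z : Fin (d + 1) → ℤ) (μ β : Fin (d + 1)) :
    conjV (bhKAt d (ctr (d + 1) L) L) (diagK (ctGen d α L κ' u)) x z (Sum.inr μ) (Sum.inl β) =
      -((L : ℝ) ^ (d + 1)) * packVH (ctE α L) L κ' u x z (Sum.inr μ) (Sum.inl β) := by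
  classical
  rw [conjV_diagK_apply, bhKAt_inr_inl, packVH_inr_inl, ctGen_inl, ctGen_inr]
  by_cases hx : off L x = 0
  · have hx' : Torus.proj L x = 0 := (off_eq_zero_iff_proj x).1 hx
    rw [if_pos hx', if_pos hx, linAvgAt_delta1_eq_pow_mul_linKerAt, ← blk_eq_quo]
    simp only [RootedKernelReflection.ctE, hx, and_true]
    have e : (z = u ∧ β = κ' ∧ κ' = α) ↔ ((β, z) = (κ', u) ∧ β = α) :=
      ⟨fun h => ⟨by rw [h.1, h.2.1], h.2.1.trans h.2.2⟩, fun h => ⟨(Prod.mk.inj h.1).2, (Prod.mk.inj h.1).1,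
        (Prod.mk.inj h.1).1.symm.trans h.2⟩⟩
    simp only [e]
    split_ifs <;> ring
  · have hx' : ¬ Torus.proj L x = 0 := fun h => hx ((off_eq_zero_iff_proj x).2 h)
    rw [if_neg hx', if_neg hx, zero_mul, mul_zero]

/-- [folklore] The multiplier–multiplier block of the contact vanishes. -/
theorem conjV_bhKAt_ctGen_inr_inr (x z : Fin (d + 1) → ℤ) (μ μ' : Fin (d + 1)) :
    conjV (bhKAt d (ctr (d + 1) L) L) (diagK (ctGen d α L κ' u)) x z (Sum.inr μ) (Sum.inr μ') = 0 := by
  rw [conjV_diagK_apply, bhKAt_inr_inr, zero_mul]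

open Classical in
/-- [folklore] **THE FIELD–FIELD BLOCK OF THE SAME CONTACT** — the predicted product-chart contact of the Wilson piece: non-zero only for
α-parallel jet bonds, equal to the `d*d`-window entry times `([x = u ∧ a = κ′] − [z = u ∧ b = κ′])`. -/
theorem conjV_bhKAt_ctGen_inl_inl (x z : Fin (d + 1) → ℤ) (a b : Fin (d + 1)) :
    conjV (bhKAt d (ctr (d + 1) L) L) (diagK (ctGen d α L κ' u)) x z (Sum.inl a) (Sum.inl b) =
      (if κ' = α then 1 else 0) * bhK L x z (Sum.inl a) (Sum.inl b) *
        ((if x = u ∧ a = κ' then 1 else 0) - (if z = u ∧ b = κ' then 1 else 0)) := by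
  rw [conjV_diagK_apply, bhKAt_inl_inl, ctGen_inl, ctGen_inl]
  by_cases hk : κ' = α
  · simp only [hk, and_true, if_true, one_mul]
    split_ifs <;> ring
  · simp only [hk, and_false, if_false, sub_self, mul_zero, zero_mul]

/-- [folklore] In particular for a jet bond NOT parallel to the reflected axis the whole contact is supported on the field–multiplier blocks. -/
theorem conjV_bhKAt_ctGen_inl_inl_of_ne (h : κ' ≠ α) (x z : Fin (d + 1) → ℤ) (a b : Fin (d + 1)) :
    conjV (bhKAt d (ctr (d + 1) L) L) (diagK (ctGen d α L κ' u)) x z (Sum.inl a) (Sum.inl b) = 0 := by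
  rw [conjV_bhKAt_ctGen_inl_inl, if_neg h, zero_mul, zero_mul]

end Contact

end

end Summit.QuantumFields.BalabanUV.Beta.BorderedHessian
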